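import Summits.HubbardSuperconductivity.HubbardSuperconductivity.Theorems.AnisotropyChordSpinMonotoneTwoMagnonRookWeightedCertU
import Summits.HubbardSuperconductivity.HubbardSuperconductivity.Theorems.AnisotropyChordSpinMonotoneTwoMagnonRookWeightedCertS

/-!
# Route `AnisotropyChord`: THEOREM R (weighted rook graphs) — the core inequality, kernel-checked
# with a human-sized certificate

**Context.**  THEOREM R of the theory seat `hubbard-h0-rotor-theory-1` (memo ROTOR-THEORY-5 §41,
2026-08-27) is the first two-magnon monotonicity theorem with TWO contact orbits and arbitrary
anisotropy: on the rook graph `K_m □ K_n` (`p = m - 1`, `q = n - 1 ≥ 1`) with direction weights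
`J₁ = 1`, `J₂ = J ∈ (0, 1]`, the two-magnon flat overlap (equivalently `⟨S⁺_tot S⁻_tot⟩`) of the
sector ground state is monotone in the anisotropy for ALL `Δ ≤ 1`.  After the three-class quotient
(ground-state class values `u, v, 1`, coupling `σ = 1 - Δ > 0`, energy `E`, eigen-equations
(E1) `u (J q + σ - E) = J q`, (E2) `v (p + σ J - E) = p`, (E3) `E = (1 - v) + J (1 - u)`) the whole
theorem is the sign of one rational function, `0 ≤ T`,
`T = (u²/J)(p + (1-J)v²)·X + v²(Jq + (J-1)u²)·Y`, `X = v(v-u) + p(1-u)`, `Y = u(u-v) + q(1-v)`.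
The theory seat kernel-checked the logic and certified `0 ≤ T` by exact Bernstein/Pólya coefficients
of two four-variable polynomial facts of degree 17 (`RookUnitSquareCert`, megabyte-size replay).

**This file** proves `0 ≤ T` at every physical point (`wrook_criterion_nonneg`, statement = the seat's
`RookCriterionNonneg` with `rookT` unfolded) by a different, human-sized route found by the prover
seat (hubbard-h0-rotor-p1, generation 6):
1. *Transfer.*  With `T̂(p,q)` := `pq` times the Jacobian bracket `F_a G_b - F_b G_a` of the flat
   overlap `F` and the ground-state curve `G` in the coordinates `a = u/q`, `b = v/p` (a polynomial,
   QUADRATIC in `(p, q)`), one has `u v · T̂ = J · T + λ · Q_c` with the constraint polynomial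
   `Q_c = v(1-u)(q+u)J² + uv(u-v)J - u(1-v)(v+p)` (`= 0` at physical points) and an explicit
   6-term `λ`.
2. *Lines.*  `Q_c` is AFFINE in `(p, q)`; along its level line through the physical point, direction
   `d = (J²v(1-u), u(1-v))`, `T̂` is a quadratic in the line parameter `s ≥ 0` measured from the base
   point `p = 1`: `T̂(p,q) = T̂(1,q₁) + s·D(1,q₁) + s²·α`, `α = J²uv (J²(1-u)³ + (1-v)³) ≥ 0`
   (in the discordant case `v > 1` because `v - 1 < J(1-u)`).
3. *Base point.*  `(J²v(1-u))² · T̂(1,q₁) = u v J² · Rp′(u,v,J)` and `J²v(1-u) · D(1,q₁) = u v J² · Da′(u,v,J)`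
   modulo `Q_c(1,q₁) = 0`, with `Rp′`, `Da′` polynomials in `(u, v, J)` ALONE (37 and 31 terms).
4. *Signs.*  `Rp′, Da′ ≥ 0` on the unit cube (concordant case, file `…RookWeightedCertU`: blow-up of
   the cubic zero at `u = v = 1` + tensor-Bernstein coefficients) and on the discordant strip
   `v = 1 + J(1-u)τ`, `τ ∈ [0,1]` (file `…RookWeightedCertS`).
Hence `T̂(p,q) ≥ 0`, hence `J·T = uv·T̂ ≥ 0`, hence `T ≥ 0`.  Everything is elementary real algebra
(`ring`, `linear_combination`, `positivity`, `nlinarith`); no definition is introduced, no graph or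
Hamiltonian appears.  The ranges lemma `wrook_ranges` is the theory seat's `rook_ranges` (Sketch5 §6).
Composition: the seat's kernel-checked wrapper (`w′ = -2pqS₁T/(nS₂³)`, Perron, Hellmann–Feynman) turns
this inequality into THEOREM R; the tree port of that wrapper over `xxzHamiltonianWith` is future work.
-/

set_option linter.dupNamespace false

namespace Summit.HubbardSuperconductivity.HubbardSuperconductivity.Theorems.AnisotropyChord.TwoMagnon

/-- Ranges at a physical point of the rook quotient (theory seat, Sketch5 `rook_ranges`): from
(E1)–(E3), `p, q ≥ 1`, `0 < J ≤ 1`, `σ > 0`, `u, v > 0` one gets `0 < E < σ` and `u < 1`. [folklore] -/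
theorem wrook_ranges {p q J σ E u v : ℝ} (hp : 1 ≤ p) (hq : 1 ≤ q) (hJ : 0 < J) (hJ1 : J ≤ 1)
    (hσ : 0 < σ) (hu : 0 < u) (hv : 0 < v)
    (e1 : u * (J * q + σ - E) = J * q) (e2 : v * (p + σ * J - E) = p)
    (e3 : E = (1 - v) + J * (1 - u)) :
    E < σ ∧ u < 1 ∧ 0 < E := by
  have hJq : 0 < J * q := mul_pos hJ (by linarith)
  have hEσ : E < σ := by
    by_contra h
    have h' : σ ≤ E := le_of_not_gt h
    have hu1 : 1 ≤ u := by
      by_contra h2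
      have h2' : u < 1 := lt_of_not_ge h2
      nlinarith [mul_nonneg hu.le (by linarith : (0:ℝ) ≤ E - σ)]
    have hv1 : v < 1 := by nlinarith [mul_nonneg hJ.le (by linarith : (0:ℝ) ≤ u - 1)]
    have hv2 : 1 ≤ v := by
      by_contra h3
      have h3' : v < 1 := lt_of_not_ge h3
      have hσJ : σ * J ≤ E := by nlinarith [mul_nonneg hσ.le (by linarith : (0:ℝ) ≤ 1 - J)]
      nlinarith [mul_nonneg hv.le (by linarith : (0:ℝ) ≤ E - σ * J)]
    linarith
  have hu1 : u < 1 := by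
    by_contra h
    have h' : 1 ≤ u := le_of_not_gt h
    nlinarith [mul_nonneg (by linarith : (0:ℝ) ≤ u - 1) (by linarith : (0:ℝ) ≤ J * q + σ - E)]
  have hE : 0 < E := by
    rcases le_or_gt v 1 with hv1 | hv1
    · nlinarith [mul_pos hJ (by linarith : (0:ℝ) < 1 - u)]
    · have : p + σ * J - E < p := by
        by_contra h
        have h' : p ≤ p + σ * J - E := le_of_not_gt h
        nlinarith [mul_le_mul_of_nonneg_left h' hv.le]
      nlinarith [mul_pos hσ hJ]
  exact ⟨hEσ, hu1, hE⟩

/-- **THEOREM R, core inequality** (`RookCriterionNonneg` of the theory seat with `rookT` unfolded):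
at every physical point of the three-class quotient of the weighted rook graph `K_{p+1} □ K_{q+1}`
(real `p, q ≥ 1`, coupling ratio `0 < J ≤ 1`, `σ = 1 - Δ > 0`, positive class values `u, v`,
eigen-equations (E1)–(E3)) the monotonicity numerator
`T = (u²/J)(p + (1-J)v²)(v(v-u) + p(1-u)) + v²(Jq + (J-1)u²)(u(u-v) + q(1-v))` is nonnegative.
Proof: transfer identity `uv·T̂ = J·T + λ·Q_c`, line decomposition
`T̂(p,q) = T̂(1,q₁) + s·D(1,q₁) + s²·α` along the level line of the affine constraint, base-point
identities reducing to `Rp′, Da′ ≥ 0` (files `…CertU`, `…CertS`); see the module docstring.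
Theory seat hubbard-h0-rotor-theory-1, ROTOR-THEORY-5 §41 (statement); this proof is new. [folklore] -/
theorem wrook_criterion_nonneg (p q J σ E u v : ℝ) (hp : 1 ≤ p) (hq : 1 ≤ q) (hJ : 0 < J)
    (hJ1 : J ≤ 1) (hσ : 0 < σ) (hu : 0 < u) (hv : 0 < v)
    (e1 : u * (J * q + σ - E) = J * q) (e2 : v * (p + σ * J - E) = p)
    (e3 : E = (1 - v) + J * (1 - u)) :
    0 ≤ (u ^ 2 / J) * (p + (1 - J) * v ^ 2) * (v * (v - u) + p * (1 - u))
        + v ^ 2 * (J * q + (J - 1) * u ^ 2) * (u * (u - v) + q * (1 - v)) := by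
  obtain ⟨hEσ, hu1, hE⟩ := wrook_ranges hp hq hJ hJ1 hσ hu hv e1 e2 e3
  -- the constraint polynomial vanishes at the physical point
  have hQ : v * (1 - u) * (q + u) * J ^ 2 + u * v * (u - v) * J - u * (1 - v) * (v + p) = 0 := by
    linear_combination (-(v * J)) * e1 + u * e2 + (u * v * (1 - J)) * e3
  -- line parameter `s ≥ 0` from the base point `p = 1` and the base-point value `q₁`
  have hd1 : 0 < J ^ 2 * v * (1 - u) := by
    have : 0 < 1 - u := by linarith
    positivity
  have h1u : (1:ℝ) - u ≠ 0 := (sub_pos.mpr hu1).ne'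
  obtain ⟨s, hs0, hp'⟩ : ∃ s : ℝ, 0 ≤ s ∧ p = 1 + s * (J ^ 2 * v * (1 - u)) :=
    ⟨(p - 1) / (J ^ 2 * v * (1 - u)), div_nonneg (by linarith) hd1.le, by field_simp [h1u, hJ.ne', hv.ne']; ring⟩
  obtain ⟨q₁, hq'⟩ : ∃ q₁ : ℝ, q = q₁ + s * (u * (1 - v)) := ⟨q - s * (u * (1 - v)), by ring⟩
  -- the constraint at the base point
  have hQ1 : J ^ 2 * v * (1 - u) * q₁ - (u * (1 - v) * (1 + v) - J * u * v * (u - v) - J ^ 2 * u * v * (1 - u)) = 0 := by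
    rw [hp', hq'] at hQ
    linear_combination hQ
  -- signs of the base-point polynomials `Rp′`, `Da′` (concordant cube / discordant strip)
  have hsigns : (0 ≤ (1 : ℝ) - v + J ^ (2:ℕ) - (2 : ℝ) * v ^ (2:ℕ) - (3 : ℝ) * J * u * v + (2 : ℝ) * J * v ^ (2:ℕ) - (3 : ℝ) * J ^ (2:ℕ) * u - (2 : ℝ) * J ^ (2:ℕ) * v
      + (2 : ℝ) * v ^ (3:ℕ) + (3 : ℝ) * J * u * v ^ (2:ℕ) + J * u ^ (2:ℕ) * v - (2 : ℝ) * J * v ^ (3:ℕ) + (3 : ℝ) * J ^ (2:ℕ) * u * v + (3 : ℝ) * J ^ (2:ℕ) * u ^ (2:ℕ)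
      + (3 : ℝ) * J ^ (2:ℕ) * v ^ (2:ℕ) + v ^ (4:ℕ) + (3 : ℝ) * J * u * v ^ (3:ℕ) - J * u ^ (2:ℕ) * v ^ (2:ℕ) - (2 : ℝ) * J * v ^ (4:ℕ) - (7 : ℝ) * J ^ (2:ℕ) * u * v ^ (2:ℕ)
      - J ^ (2:ℕ) * u ^ (3:ℕ) + (2 : ℝ) * J ^ (2:ℕ) * v ^ (3:ℕ) - J ^ (3:ℕ) * v ^ (2:ℕ) - v ^ (5:ℕ) - (3 : ℝ) * J * u * v ^ (4:ℕ) - J * u ^ (2:ℕ) * v ^ (3:ℕ)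
      + (2 : ℝ) * J * v ^ (5:ℕ) - (8 : ℝ) * J ^ (2:ℕ) * u * v ^ (3:ℕ) + (7 : ℝ) * J ^ (2:ℕ) * u ^ (2:ℕ) * v ^ (2:ℕ) - J ^ (2:ℕ) * u ^ (3:ℕ) * v + J ^ (2:ℕ) * v ^ (4:ℕ)
      + (6 : ℝ) * J ^ (3:ℕ) * u * v ^ (2:ℕ) - (2 : ℝ) * J ^ (3:ℕ) * v ^ (3:ℕ) + J ^ (4:ℕ) * v ^ (2:ℕ) + J * u ^ (2:ℕ) * v ^ (4:ℕ) + (3 : ℝ) * J ^ (2:ℕ) * u * v ^ (4:ℕ)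
      + (3 : ℝ) * J ^ (2:ℕ) * u ^ (2:ℕ) * v ^ (3:ℕ) - (2 : ℝ) * J ^ (2:ℕ) * u ^ (3:ℕ) * v ^ (2:ℕ) - J ^ (2:ℕ) * v ^ (5:ℕ) + (4 : ℝ) * J ^ (3:ℕ) * u * v ^ (3:ℕ)
      - (10 : ℝ) * J ^ (3:ℕ) * u ^ (2:ℕ) * v ^ (2:ℕ) - (4 : ℝ) * J ^ (4:ℕ) * u * v ^ (2:ℕ) - J ^ (2:ℕ) * u ^ (2:ℕ) * v ^ (4:ℕ) - (2 : ℝ) * J ^ (3:ℕ) * u ^ (2:ℕ) * v ^ (3:ℕ)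
      + (6 : ℝ) * J ^ (3:ℕ) * u ^ (3:ℕ) * v ^ (2:ℕ) + (6 : ℝ) * J ^ (4:ℕ) * u ^ (2:ℕ) * v ^ (2:ℕ) - J ^ (3:ℕ) * u ^ (4:ℕ) * v ^ (2:ℕ)
      - (4 : ℝ) * J ^ (4:ℕ) * u ^ (3:ℕ) * v ^ (2:ℕ) + J ^ (4:ℕ) * u ^ (4:ℕ) * v ^ (2:ℕ)) ∧ (0 ≤ (2 : ℝ) - (4 : ℝ) * v + (2 : ℝ) * J ^ (2:ℕ) - (3 : ℝ) * J * u * v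
      + (2 : ℝ) * J * v ^ (2:ℕ) - (6 : ℝ) * J ^ (2:ℕ) * u - (2 : ℝ) * J ^ (2:ℕ) * v + (4 : ℝ) * v ^ (3:ℕ) + (6 : ℝ) * J * u * v ^ (2:ℕ) + J * u ^ (2:ℕ) * v
      - (4 : ℝ) * J * v ^ (3:ℕ) + (3 : ℝ) * J ^ (2:ℕ) * u * v + (6 : ℝ) * J ^ (2:ℕ) * u ^ (2:ℕ) + (5 : ℝ) * J ^ (2:ℕ) * v ^ (2:ℕ) - (2 : ℝ) * v ^ (4:ℕ)
      - (3 : ℝ) * J * u * v ^ (3:ℕ) - (2 : ℝ) * J * u ^ (2:ℕ) * v ^ (2:ℕ) + (2 : ℝ) * J * v ^ (4:ℕ) - (11 : ℝ) * J ^ (2:ℕ) * u * v ^ (2:ℕ) - (2 : ℝ) * J ^ (2:ℕ) * u ^ (3:ℕ)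
      - J ^ (2:ℕ) * v ^ (3:ℕ) - J ^ (3:ℕ) * v ^ (2:ℕ) + J * u ^ (2:ℕ) * v ^ (3:ℕ) + (2 : ℝ) * J ^ (2:ℕ) * u * v ^ (3:ℕ) + (7 : ℝ) * J ^ (2:ℕ) * u ^ (2:ℕ) * v ^ (2:ℕ)
      - J ^ (2:ℕ) * u ^ (3:ℕ) * v + (3 : ℝ) * J ^ (3:ℕ) * u * v ^ (2:ℕ) - J ^ (2:ℕ) * u ^ (2:ℕ) * v ^ (3:ℕ) - J ^ (2:ℕ) * u ^ (3:ℕ) * v ^ (2:ℕ)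
      - (3 : ℝ) * J ^ (3:ℕ) * u ^ (2:ℕ) * v ^ (2:ℕ) + J ^ (3:ℕ) * u ^ (3:ℕ) * v ^ (2:ℕ)) ∧ 0 ≤ J ^ 2 * (1 - u) ^ 3 + (1 - v) ^ 3 := by
    rcases le_or_gt v 1 with hv1 | hv1
    · refine ⟨wrook_rp_nonneg_cube u v J hu.le hu1.le hv.le hv1 hJ.le hJ1,
        wrook_da_nonneg_cube u v J hu.le hu1.le hv.le hv1 hJ.le hJ1, ?_⟩
      have h1 : 0 ≤ 1 - u := by linarith
      have h2 : 0 ≤ 1 - v := by linarith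
      positivity
    · -- discordant strip: `0 < v - 1 < J (1 - u)`; write `v = 1 + J (1 - u) τ`
      have hJu : 0 < J * (1 - u) := mul_pos hJ (by linarith)
      have hlt : v - 1 < J * (1 - u) := by linarith
      obtain ⟨τ, hτ0, hτ1, hv'⟩ : ∃ τ : ℝ, 0 ≤ τ ∧ τ ≤ 1 ∧ v = 1 + J * (1 - u) * τ :=
        ⟨(v - 1) / (J * (1 - u)), div_nonneg (by linarith) hJu.le,
          (div_le_one hJu).mpr hlt.le, by field_simp [h1u, hJ.ne']; ring⟩
      refine ⟨(wrook_rp_nonneg_strip u τ J hu.le hu1.le hτ0 hτ1 hJ.le hJ1).trans_eq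
          (by rw [hv']; ring),
        (wrook_da_nonneg_strip u τ J hu.le hu1.le hτ0 hτ1 hJ.le hJ1).trans_eq (by rw [hv']; ring), ?_⟩
      -- `(v-1)³ ≤ (J(1-u))³ ≤ J²(1-u)³` since `J ≤ 1`
      have h3 : (v - 1) ^ 3 ≤ (J * (1 - u)) ^ 3 :=
        pow_le_pow_left₀ (by linarith) hlt.le 3
      have h4 : (J * (1 - u)) ^ 3 ≤ J ^ 2 * (1 - u) ^ 3 := by
        have h1u : 0 ≤ (1 - u) ^ 3 := pow_nonneg (by linarith) 3
        nlinarith [mul_nonneg (mul_nonneg hJ.le hJ.le) h1u, mul_pow J (1 - u) 3]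
      nlinarith [h3, h4]
  obtain ⟨hRp, hDa, hα⟩ := hsigns
  -- base-point value: `D1² · T̂(1,q₁) = κ · (D1 q₁ - N1) + u v J² Rp′`
  have hbase : 0 ≤ q₁ - q₁ * v + u * v + u ^ (2:ℕ) - (2 : ℝ) * J * u * v + J * u ^ (2:ℕ) + J ^ (2:ℕ) * q₁ + J ^ (2:ℕ) * u - q₁ * v ^ (2:ℕ) - (2 : ℝ) * u ^ (2:ℕ) * v
      - (2 : ℝ) * J * q₁ * u * v + J * q₁ * v ^ (2:ℕ) + (2 : ℝ) * J * u ^ (2:ℕ) * v - J * u ^ (3:ℕ) - (2 : ℝ) * J ^ (2:ℕ) * q₁ * u - J ^ (2:ℕ) * q₁ * v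
      - (2 : ℝ) * J ^ (2:ℕ) * u ^ (2:ℕ) + q₁ * v ^ (3:ℕ) + (3 : ℝ) * u * v ^ (3:ℕ) - (3 : ℝ) * u ^ (2:ℕ) * v ^ (2:ℕ) + (2 : ℝ) * J * q₁ * u * v ^ (2:ℕ) - J * q₁ * v ^ (3:ℕ)
      - (3 : ℝ) * J * u * v ^ (3:ℕ) + (6 : ℝ) * J * u ^ (2:ℕ) * v ^ (2:ℕ) - (3 : ℝ) * J * u ^ (3:ℕ) * v + J ^ (2:ℕ) * q₁ * u * v + J ^ (2:ℕ) * q₁ * u ^ (2:ℕ)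
      + (2 : ℝ) * J ^ (2:ℕ) * q₁ * v ^ (2:ℕ) + J ^ (2:ℕ) * q₁ ^ (2:ℕ) * v + (2 : ℝ) * J ^ (2:ℕ) * u * v ^ (2:ℕ) - (2 : ℝ) * J ^ (2:ℕ) * u ^ (2:ℕ) * v + J ^ (2:ℕ) * u ^ (3:ℕ)
      - (4 : ℝ) * J ^ (2:ℕ) * q₁ * u * v ^ (2:ℕ) + (2 : ℝ) * J ^ (2:ℕ) * q₁ * u ^ (2:ℕ) * v - J ^ (2:ℕ) * q₁ ^ (2:ℕ) * v ^ (2:ℕ) - (3 : ℝ) * J ^ (2:ℕ) * u ^ (2:ℕ) * v ^ (2:ℕ)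
      + (3 : ℝ) * J ^ (2:ℕ) * u ^ (3:ℕ) * v := by
    have key : (J ^ 2 * v * (1 - u)) ^ 2 * (q₁ - q₁ * v + u * v + u ^ (2:ℕ) - (2 : ℝ) * J * u * v + J * u ^ (2:ℕ) + J ^ (2:ℕ) * q₁ + J ^ (2:ℕ) * u - q₁ * v ^ (2:ℕ)
        - (2 : ℝ) * u ^ (2:ℕ) * v - (2 : ℝ) * J * q₁ * u * v + J * q₁ * v ^ (2:ℕ) + (2 : ℝ) * J * u ^ (2:ℕ) * v - J * u ^ (3:ℕ) - (2 : ℝ) * J ^ (2:ℕ) * q₁ * u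
        - J ^ (2:ℕ) * q₁ * v - (2 : ℝ) * J ^ (2:ℕ) * u ^ (2:ℕ) + q₁ * v ^ (3:ℕ) + (3 : ℝ) * u * v ^ (3:ℕ) - (3 : ℝ) * u ^ (2:ℕ) * v ^ (2:ℕ) + (2 : ℝ) * J * q₁ * u * v ^ (2:ℕ)
        - J * q₁ * v ^ (3:ℕ) - (3 : ℝ) * J * u * v ^ (3:ℕ) + (6 : ℝ) * J * u ^ (2:ℕ) * v ^ (2:ℕ) - (3 : ℝ) * J * u ^ (3:ℕ) * v + J ^ (2:ℕ) * q₁ * u * v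
        + J ^ (2:ℕ) * q₁ * u ^ (2:ℕ) + (2 : ℝ) * J ^ (2:ℕ) * q₁ * v ^ (2:ℕ) + J ^ (2:ℕ) * q₁ ^ (2:ℕ) * v + (2 : ℝ) * J ^ (2:ℕ) * u * v ^ (2:ℕ)
        - (2 : ℝ) * J ^ (2:ℕ) * u ^ (2:ℕ) * v + J ^ (2:ℕ) * u ^ (3:ℕ) - (4 : ℝ) * J ^ (2:ℕ) * q₁ * u * v ^ (2:ℕ) + (2 : ℝ) * J ^ (2:ℕ) * q₁ * u ^ (2:ℕ) * v
        - J ^ (2:ℕ) * q₁ ^ (2:ℕ) * v ^ (2:ℕ) - (3 : ℝ) * J ^ (2:ℕ) * u ^ (2:ℕ) * v ^ (2:ℕ) + (3 : ℝ) * J ^ (2:ℕ) * u ^ (3:ℕ) * v)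
        = (J ^ (2:ℕ) * v - J ^ (2:ℕ) * v ^ (2:ℕ) - J ^ (2:ℕ) * v ^ (3:ℕ) + J ^ (4:ℕ) * v + J ^ (2:ℕ) * v ^ (4:ℕ) - (2 : ℝ) * J ^ (3:ℕ) * u * v ^ (2:ℕ) + J ^ (3:ℕ) * v ^ (3:ℕ)
            - (3 : ℝ) * J ^ (4:ℕ) * u * v - J ^ (4:ℕ) * v ^ (2:ℕ) + (2 : ℝ) * J ^ (3:ℕ) * u * v ^ (3:ℕ) + J ^ (3:ℕ) * u ^ (2:ℕ) * v ^ (2:ℕ) - J ^ (3:ℕ) * v ^ (4:ℕ)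
            + J ^ (4:ℕ) * q₁ * v ^ (2:ℕ) + J ^ (4:ℕ) * u * v ^ (2:ℕ) + (3 : ℝ) * J ^ (4:ℕ) * u ^ (2:ℕ) * v + (2 : ℝ) * J ^ (4:ℕ) * v ^ (3:ℕ) - J ^ (3:ℕ) * u ^ (2:ℕ) * v ^ (3:ℕ)
            - J ^ (4:ℕ) * q₁ * u * v ^ (2:ℕ) - J ^ (4:ℕ) * q₁ * v ^ (3:ℕ) - (5 : ℝ) * J ^ (4:ℕ) * u * v ^ (3:ℕ) + (2 : ℝ) * J ^ (4:ℕ) * u ^ (2:ℕ) * v ^ (2:ℕ)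
            - J ^ (4:ℕ) * u ^ (3:ℕ) * v + J ^ (4:ℕ) * q₁ * u * v ^ (3:ℕ) + (3 : ℝ) * J ^ (4:ℕ) * u ^ (2:ℕ) * v ^ (3:ℕ)
            - (2 : ℝ) * J ^ (4:ℕ) * u ^ (3:ℕ) * v ^ (2:ℕ)) * (J ^ 2 * v * (1 - u) * q₁ - (u * (1 - v) * (1 + v) - J * u * v * (u - v) - J ^ 2 * u * v * (1 - u)))
          + u * v * J ^ 2 * ((1 : ℝ) - v + J ^ (2:ℕ) - (2 : ℝ) * v ^ (2:ℕ) - (3 : ℝ) * J * u * v + (2 : ℝ) * J * v ^ (2:ℕ) - (3 : ℝ) * J ^ (2:ℕ) * u - (2 : ℝ) * J ^ (2:ℕ) * v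
              + (2 : ℝ) * v ^ (3:ℕ) + (3 : ℝ) * J * u * v ^ (2:ℕ) + J * u ^ (2:ℕ) * v - (2 : ℝ) * J * v ^ (3:ℕ) + (3 : ℝ) * J ^ (2:ℕ) * u * v + (3 : ℝ) * J ^ (2:ℕ) * u ^ (2:ℕ)
              + (3 : ℝ) * J ^ (2:ℕ) * v ^ (2:ℕ) + v ^ (4:ℕ) + (3 : ℝ) * J * u * v ^ (3:ℕ) - J * u ^ (2:ℕ) * v ^ (2:ℕ) - (2 : ℝ) * J * v ^ (4:ℕ)
              - (7 : ℝ) * J ^ (2:ℕ) * u * v ^ (2:ℕ) - J ^ (2:ℕ) * u ^ (3:ℕ) + (2 : ℝ) * J ^ (2:ℕ) * v ^ (3:ℕ) - J ^ (3:ℕ) * v ^ (2:ℕ) - v ^ (5:ℕ) - (3 : ℝ) * J * u * v ^ (4:ℕ)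
              - J * u ^ (2:ℕ) * v ^ (3:ℕ) + (2 : ℝ) * J * v ^ (5:ℕ) - (8 : ℝ) * J ^ (2:ℕ) * u * v ^ (3:ℕ) + (7 : ℝ) * J ^ (2:ℕ) * u ^ (2:ℕ) * v ^ (2:ℕ)
              - J ^ (2:ℕ) * u ^ (3:ℕ) * v + J ^ (2:ℕ) * v ^ (4:ℕ) + (6 : ℝ) * J ^ (3:ℕ) * u * v ^ (2:ℕ) - (2 : ℝ) * J ^ (3:ℕ) * v ^ (3:ℕ) + J ^ (4:ℕ) * v ^ (2:ℕ)
              + J * u ^ (2:ℕ) * v ^ (4:ℕ) + (3 : ℝ) * J ^ (2:ℕ) * u * v ^ (4:ℕ) + (3 : ℝ) * J ^ (2:ℕ) * u ^ (2:ℕ) * v ^ (3:ℕ) - (2 : ℝ) * J ^ (2:ℕ) * u ^ (3:ℕ) * v ^ (2:ℕ)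
              - J ^ (2:ℕ) * v ^ (5:ℕ) + (4 : ℝ) * J ^ (3:ℕ) * u * v ^ (3:ℕ) - (10 : ℝ) * J ^ (3:ℕ) * u ^ (2:ℕ) * v ^ (2:ℕ) - (4 : ℝ) * J ^ (4:ℕ) * u * v ^ (2:ℕ)
              - J ^ (2:ℕ) * u ^ (2:ℕ) * v ^ (4:ℕ) - (2 : ℝ) * J ^ (3:ℕ) * u ^ (2:ℕ) * v ^ (3:ℕ) + (6 : ℝ) * J ^ (3:ℕ) * u ^ (3:ℕ) * v ^ (2:ℕ)
              + (6 : ℝ) * J ^ (4:ℕ) * u ^ (2:ℕ) * v ^ (2:ℕ) - J ^ (3:ℕ) * u ^ (4:ℕ) * v ^ (2:ℕ) - (4 : ℝ) * J ^ (4:ℕ) * u ^ (3:ℕ) * v ^ (2:ℕ)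
              + J ^ (4:ℕ) * u ^ (4:ℕ) * v ^ (2:ℕ)) := by
      ring
    rw [hQ1, mul_zero, zero_add] at key
    have hpos : 0 < (J ^ 2 * v * (1 - u)) ^ 2 := pow_pos hd1 2
    have : 0 ≤ (J ^ 2 * v * (1 - u)) ^ 2 * (q₁ - q₁ * v + u * v + u ^ (2:ℕ) - (2 : ℝ) * J * u * v + J * u ^ (2:ℕ) + J ^ (2:ℕ) * q₁ + J ^ (2:ℕ) * u - q₁ * v ^ (2:ℕ)
        - (2 : ℝ) * u ^ (2:ℕ) * v - (2 : ℝ) * J * q₁ * u * v + J * q₁ * v ^ (2:ℕ) + (2 : ℝ) * J * u ^ (2:ℕ) * v - J * u ^ (3:ℕ) - (2 : ℝ) * J ^ (2:ℕ) * q₁ * u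
        - J ^ (2:ℕ) * q₁ * v - (2 : ℝ) * J ^ (2:ℕ) * u ^ (2:ℕ) + q₁ * v ^ (3:ℕ) + (3 : ℝ) * u * v ^ (3:ℕ) - (3 : ℝ) * u ^ (2:ℕ) * v ^ (2:ℕ) + (2 : ℝ) * J * q₁ * u * v ^ (2:ℕ)
        - J * q₁ * v ^ (3:ℕ) - (3 : ℝ) * J * u * v ^ (3:ℕ) + (6 : ℝ) * J * u ^ (2:ℕ) * v ^ (2:ℕ) - (3 : ℝ) * J * u ^ (3:ℕ) * v + J ^ (2:ℕ) * q₁ * u * v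
        + J ^ (2:ℕ) * q₁ * u ^ (2:ℕ) + (2 : ℝ) * J ^ (2:ℕ) * q₁ * v ^ (2:ℕ) + J ^ (2:ℕ) * q₁ ^ (2:ℕ) * v + (2 : ℝ) * J ^ (2:ℕ) * u * v ^ (2:ℕ)
        - (2 : ℝ) * J ^ (2:ℕ) * u ^ (2:ℕ) * v + J ^ (2:ℕ) * u ^ (3:ℕ) - (4 : ℝ) * J ^ (2:ℕ) * q₁ * u * v ^ (2:ℕ) + (2 : ℝ) * J ^ (2:ℕ) * q₁ * u ^ (2:ℕ) * v
        - J ^ (2:ℕ) * q₁ ^ (2:ℕ) * v ^ (2:ℕ) - (3 : ℝ) * J ^ (2:ℕ) * u ^ (2:ℕ) * v ^ (2:ℕ) + (3 : ℝ) * J ^ (2:ℕ) * u ^ (3:ℕ) * v) := by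
      rw [key]; exact mul_nonneg (by positivity) hRp
    exact (mul_nonneg_iff_of_pos_left hpos).mp this
  -- base-point slope: `D1 · D(1,q₁) = ε₁ · (D1 q₁ - N1) + u v J² Da′`
  have hslope : 0 ≤ u - (2 : ℝ) * u * v + J ^ (2:ℕ) * u + J * u * v ^ (2:ℕ) - (2 : ℝ) * J * u ^ (2:ℕ) * v + J ^ (2:ℕ) * q₁ * v - J ^ (2:ℕ) * u * v
      - (2 : ℝ) * J ^ (2:ℕ) * u ^ (2:ℕ) + (2 : ℝ) * u * v ^ (3:ℕ) - (2 : ℝ) * J * u * v ^ (3:ℕ) + (4 : ℝ) * J * u ^ (2:ℕ) * v ^ (2:ℕ) + J ^ (2:ℕ) * q₁ * u * v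
      - (2 : ℝ) * J ^ (2:ℕ) * q₁ * v ^ (2:ℕ) + (4 : ℝ) * J ^ (2:ℕ) * u * v ^ (2:ℕ) + (2 : ℝ) * J ^ (2:ℕ) * u ^ (2:ℕ) * v + J ^ (2:ℕ) * u ^ (3:ℕ) - u * v ^ (4:ℕ)
      + J * u * v ^ (4:ℕ) - (2 : ℝ) * J * u ^ (2:ℕ) * v ^ (3:ℕ) - (2 : ℝ) * J ^ (2:ℕ) * q₁ * u * v ^ (2:ℕ) + J ^ (2:ℕ) * q₁ * v ^ (3:ℕ)
      - (10 : ℝ) * J ^ (2:ℕ) * u ^ (2:ℕ) * v ^ (2:ℕ) + J ^ (2:ℕ) * u ^ (3:ℕ) * v - (2 : ℝ) * J ^ (3:ℕ) * u * v ^ (2:ℕ) + J ^ (3:ℕ) * u ^ (2:ℕ) * v + J ^ (4:ℕ) * q₁ * v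
      + J ^ (4:ℕ) * u * v + J ^ (2:ℕ) * q₁ * u * v ^ (3:ℕ) + (2 : ℝ) * J ^ (2:ℕ) * u ^ (2:ℕ) * v ^ (3:ℕ) + (2 : ℝ) * J ^ (2:ℕ) * u ^ (3:ℕ) * v ^ (2:ℕ)
      + (4 : ℝ) * J ^ (3:ℕ) * u ^ (2:ℕ) * v ^ (2:ℕ) - (2 : ℝ) * J ^ (3:ℕ) * u ^ (3:ℕ) * v - (3 : ℝ) * J ^ (4:ℕ) * q₁ * u * v - (3 : ℝ) * J ^ (4:ℕ) * u ^ (2:ℕ) * v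
      - (2 : ℝ) * J ^ (3:ℕ) * u ^ (3:ℕ) * v ^ (2:ℕ) + J ^ (3:ℕ) * u ^ (4:ℕ) * v + (3 : ℝ) * J ^ (4:ℕ) * q₁ * u ^ (2:ℕ) * v + (3 : ℝ) * J ^ (4:ℕ) * u ^ (3:ℕ) * v
      - J ^ (4:ℕ) * q₁ * u ^ (3:ℕ) * v - J ^ (4:ℕ) * u ^ (4:ℕ) * v := by
    have key : (J ^ 2 * v * (1 - u)) * (u - (2 : ℝ) * u * v + J ^ (2:ℕ) * u + J * u * v ^ (2:ℕ) - (2 : ℝ) * J * u ^ (2:ℕ) * v + J ^ (2:ℕ) * q₁ * v - J ^ (2:ℕ) * u * v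
        - (2 : ℝ) * J ^ (2:ℕ) * u ^ (2:ℕ) + (2 : ℝ) * u * v ^ (3:ℕ) - (2 : ℝ) * J * u * v ^ (3:ℕ) + (4 : ℝ) * J * u ^ (2:ℕ) * v ^ (2:ℕ) + J ^ (2:ℕ) * q₁ * u * v
        - (2 : ℝ) * J ^ (2:ℕ) * q₁ * v ^ (2:ℕ) + (4 : ℝ) * J ^ (2:ℕ) * u * v ^ (2:ℕ) + (2 : ℝ) * J ^ (2:ℕ) * u ^ (2:ℕ) * v + J ^ (2:ℕ) * u ^ (3:ℕ) - u * v ^ (4:ℕ)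
        + J * u * v ^ (4:ℕ) - (2 : ℝ) * J * u ^ (2:ℕ) * v ^ (3:ℕ) - (2 : ℝ) * J ^ (2:ℕ) * q₁ * u * v ^ (2:ℕ) + J ^ (2:ℕ) * q₁ * v ^ (3:ℕ)
        - (10 : ℝ) * J ^ (2:ℕ) * u ^ (2:ℕ) * v ^ (2:ℕ) + J ^ (2:ℕ) * u ^ (3:ℕ) * v - (2 : ℝ) * J ^ (3:ℕ) * u * v ^ (2:ℕ) + J ^ (3:ℕ) * u ^ (2:ℕ) * v + J ^ (4:ℕ) * q₁ * v
        + J ^ (4:ℕ) * u * v + J ^ (2:ℕ) * q₁ * u * v ^ (3:ℕ) + (2 : ℝ) * J ^ (2:ℕ) * u ^ (2:ℕ) * v ^ (3:ℕ) + (2 : ℝ) * J ^ (2:ℕ) * u ^ (3:ℕ) * v ^ (2:ℕ)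
        + (4 : ℝ) * J ^ (3:ℕ) * u ^ (2:ℕ) * v ^ (2:ℕ) - (2 : ℝ) * J ^ (3:ℕ) * u ^ (3:ℕ) * v - (3 : ℝ) * J ^ (4:ℕ) * q₁ * u * v - (3 : ℝ) * J ^ (4:ℕ) * u ^ (2:ℕ) * v
        - (2 : ℝ) * J ^ (3:ℕ) * u ^ (3:ℕ) * v ^ (2:ℕ) + J ^ (3:ℕ) * u ^ (4:ℕ) * v + (3 : ℝ) * J ^ (4:ℕ) * q₁ * u ^ (2:ℕ) * v + (3 : ℝ) * J ^ (4:ℕ) * u ^ (3:ℕ) * v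
        - J ^ (4:ℕ) * q₁ * u ^ (3:ℕ) * v - J ^ (4:ℕ) * u ^ (4:ℕ) * v)
        = (J ^ (2:ℕ) * v + J ^ (2:ℕ) * u * v - (2 : ℝ) * J ^ (2:ℕ) * v ^ (2:ℕ) - (2 : ℝ) * J ^ (2:ℕ) * u * v ^ (2:ℕ) + J ^ (2:ℕ) * v ^ (3:ℕ) + J ^ (4:ℕ) * v
            + J ^ (2:ℕ) * u * v ^ (3:ℕ) - (3 : ℝ) * J ^ (4:ℕ) * u * v + (3 : ℝ) * J ^ (4:ℕ) * u ^ (2:ℕ) * v - J ^ (4:ℕ) * u ^ (3:ℕ) * v) * (J ^ 2 * v * (1 - u) * q₁ - (u * (1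
            - v) * (1 + v) - J * u * v * (u - v) - J ^ 2 * u * v * (1 - u)))
          + u * v * J ^ 2 * ((2 : ℝ) - (4 : ℝ) * v + (2 : ℝ) * J ^ (2:ℕ) - (3 : ℝ) * J * u * v + (2 : ℝ) * J * v ^ (2:ℕ) - (6 : ℝ) * J ^ (2:ℕ) * u - (2 : ℝ) * J ^ (2:ℕ) * v
              + (4 : ℝ) * v ^ (3:ℕ) + (6 : ℝ) * J * u * v ^ (2:ℕ) + J * u ^ (2:ℕ) * v - (4 : ℝ) * J * v ^ (3:ℕ) + (3 : ℝ) * J ^ (2:ℕ) * u * v + (6 : ℝ) * J ^ (2:ℕ) * u ^ (2:ℕ)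
              + (5 : ℝ) * J ^ (2:ℕ) * v ^ (2:ℕ) - (2 : ℝ) * v ^ (4:ℕ) - (3 : ℝ) * J * u * v ^ (3:ℕ) - (2 : ℝ) * J * u ^ (2:ℕ) * v ^ (2:ℕ) + (2 : ℝ) * J * v ^ (4:ℕ)
              - (11 : ℝ) * J ^ (2:ℕ) * u * v ^ (2:ℕ) - (2 : ℝ) * J ^ (2:ℕ) * u ^ (3:ℕ) - J ^ (2:ℕ) * v ^ (3:ℕ) - J ^ (3:ℕ) * v ^ (2:ℕ) + J * u ^ (2:ℕ) * v ^ (3:ℕ)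
              + (2 : ℝ) * J ^ (2:ℕ) * u * v ^ (3:ℕ) + (7 : ℝ) * J ^ (2:ℕ) * u ^ (2:ℕ) * v ^ (2:ℕ) - J ^ (2:ℕ) * u ^ (3:ℕ) * v + (3 : ℝ) * J ^ (3:ℕ) * u * v ^ (2:ℕ)
              - J ^ (2:ℕ) * u ^ (2:ℕ) * v ^ (3:ℕ) - J ^ (2:ℕ) * u ^ (3:ℕ) * v ^ (2:ℕ) - (3 : ℝ) * J ^ (3:ℕ) * u ^ (2:ℕ) * v ^ (2:ℕ) + J ^ (3:ℕ) * u ^ (3:ℕ) * v ^ (2:ℕ)) := by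
      ring
    rw [hQ1, mul_zero, zero_add] at key
    have : 0 ≤ (J ^ 2 * v * (1 - u)) * (u - (2 : ℝ) * u * v + J ^ (2:ℕ) * u + J * u * v ^ (2:ℕ) - (2 : ℝ) * J * u ^ (2:ℕ) * v + J ^ (2:ℕ) * q₁ * v - J ^ (2:ℕ) * u * v
        - (2 : ℝ) * J ^ (2:ℕ) * u ^ (2:ℕ) + (2 : ℝ) * u * v ^ (3:ℕ) - (2 : ℝ) * J * u * v ^ (3:ℕ) + (4 : ℝ) * J * u ^ (2:ℕ) * v ^ (2:ℕ) + J ^ (2:ℕ) * q₁ * u * v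
        - (2 : ℝ) * J ^ (2:ℕ) * q₁ * v ^ (2:ℕ) + (4 : ℝ) * J ^ (2:ℕ) * u * v ^ (2:ℕ) + (2 : ℝ) * J ^ (2:ℕ) * u ^ (2:ℕ) * v + J ^ (2:ℕ) * u ^ (3:ℕ) - u * v ^ (4:ℕ)
        + J * u * v ^ (4:ℕ) - (2 : ℝ) * J * u ^ (2:ℕ) * v ^ (3:ℕ) - (2 : ℝ) * J ^ (2:ℕ) * q₁ * u * v ^ (2:ℕ) + J ^ (2:ℕ) * q₁ * v ^ (3:ℕ)
        - (10 : ℝ) * J ^ (2:ℕ) * u ^ (2:ℕ) * v ^ (2:ℕ) + J ^ (2:ℕ) * u ^ (3:ℕ) * v - (2 : ℝ) * J ^ (3:ℕ) * u * v ^ (2:ℕ) + J ^ (3:ℕ) * u ^ (2:ℕ) * v + J ^ (4:ℕ) * q₁ * v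
        + J ^ (4:ℕ) * u * v + J ^ (2:ℕ) * q₁ * u * v ^ (3:ℕ) + (2 : ℝ) * J ^ (2:ℕ) * u ^ (2:ℕ) * v ^ (3:ℕ) + (2 : ℝ) * J ^ (2:ℕ) * u ^ (3:ℕ) * v ^ (2:ℕ)
        + (4 : ℝ) * J ^ (3:ℕ) * u ^ (2:ℕ) * v ^ (2:ℕ) - (2 : ℝ) * J ^ (3:ℕ) * u ^ (3:ℕ) * v - (3 : ℝ) * J ^ (4:ℕ) * q₁ * u * v - (3 : ℝ) * J ^ (4:ℕ) * u ^ (2:ℕ) * v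
        - (2 : ℝ) * J ^ (3:ℕ) * u ^ (3:ℕ) * v ^ (2:ℕ) + J ^ (3:ℕ) * u ^ (4:ℕ) * v + (3 : ℝ) * J ^ (4:ℕ) * q₁ * u ^ (2:ℕ) * v + (3 : ℝ) * J ^ (4:ℕ) * u ^ (3:ℕ) * v
        - J ^ (4:ℕ) * q₁ * u ^ (3:ℕ) * v - J ^ (4:ℕ) * u ^ (4:ℕ) * v) := by
      rw [key]; exact mul_nonneg (by positivity) hDa
    exact (mul_nonneg_iff_of_pos_left hd1).mp this
  -- the line decomposition of `T̂`
  have hline : p * q - p * u + q * v - (2 : ℝ) * p * q * v + p * u * v + (2 : ℝ) * p * u ^ (2:ℕ) + p ^ (2:ℕ) * u - (2 : ℝ) * q * v ^ (2:ℕ) - (2 : ℝ) * u * v ^ (2:ℕ)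
      + (2 : ℝ) * u ^ (2:ℕ) * v - (2 : ℝ) * J * p * u * v + J * p * u ^ (2:ℕ) - (2 : ℝ) * J * q * u * v + J * q * v ^ (2:ℕ) + J ^ (2:ℕ) * p * q + J ^ (2:ℕ) * p * u
      - J ^ (2:ℕ) * q * v + p * q * v ^ (2:ℕ) + (2 : ℝ) * p * u * v ^ (2:ℕ) - (4 : ℝ) * p * u ^ (2:ℕ) * v - p ^ (2:ℕ) * u ^ (2:ℕ) + q * v ^ (3:ℕ) + (3 : ℝ) * u * v ^ (3:ℕ)
      - (3 : ℝ) * u ^ (2:ℕ) * v ^ (2:ℕ) + (2 : ℝ) * J * p * u ^ (2:ℕ) * v - J * p * u ^ (3:ℕ) + (2 : ℝ) * J * q * u * v ^ (2:ℕ) - J * q * v ^ (3:ℕ) - (3 : ℝ) * J * u * v ^ (3:ℕ)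
      + (6 : ℝ) * J * u ^ (2:ℕ) * v ^ (2:ℕ) - (3 : ℝ) * J * u ^ (3:ℕ) * v - (2 : ℝ) * J ^ (2:ℕ) * p * q * u - (2 : ℝ) * J ^ (2:ℕ) * p * u ^ (2:ℕ) + J ^ (2:ℕ) * q * u * v
      + (2 : ℝ) * J ^ (2:ℕ) * q * v ^ (2:ℕ) + J ^ (2:ℕ) * q ^ (2:ℕ) * v + (2 : ℝ) * J ^ (2:ℕ) * u * v ^ (2:ℕ) - (2 : ℝ) * J ^ (2:ℕ) * u ^ (2:ℕ) * v
      + J ^ (2:ℕ) * p * q * u ^ (2:ℕ) + J ^ (2:ℕ) * p * u ^ (3:ℕ) - (4 : ℝ) * J ^ (2:ℕ) * q * u * v ^ (2:ℕ) + (2 : ℝ) * J ^ (2:ℕ) * q * u ^ (2:ℕ) * v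
      - J ^ (2:ℕ) * q ^ (2:ℕ) * v ^ (2:ℕ) - (3 : ℝ) * J ^ (2:ℕ) * u ^ (2:ℕ) * v ^ (2:ℕ) + (3 : ℝ) * J ^ (2:ℕ) * u ^ (3:ℕ) * v
      = (q₁ - q₁ * v + u * v + u ^ (2:ℕ) - (2 : ℝ) * J * u * v + J * u ^ (2:ℕ) + J ^ (2:ℕ) * q₁ + J ^ (2:ℕ) * u - q₁ * v ^ (2:ℕ) - (2 : ℝ) * u ^ (2:ℕ) * v
          - (2 : ℝ) * J * q₁ * u * v + J * q₁ * v ^ (2:ℕ) + (2 : ℝ) * J * u ^ (2:ℕ) * v - J * u ^ (3:ℕ) - (2 : ℝ) * J ^ (2:ℕ) * q₁ * u - J ^ (2:ℕ) * q₁ * v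
          - (2 : ℝ) * J ^ (2:ℕ) * u ^ (2:ℕ) + q₁ * v ^ (3:ℕ) + (3 : ℝ) * u * v ^ (3:ℕ) - (3 : ℝ) * u ^ (2:ℕ) * v ^ (2:ℕ) + (2 : ℝ) * J * q₁ * u * v ^ (2:ℕ) - J * q₁ * v ^ (3:ℕ)
          - (3 : ℝ) * J * u * v ^ (3:ℕ) + (6 : ℝ) * J * u ^ (2:ℕ) * v ^ (2:ℕ) - (3 : ℝ) * J * u ^ (3:ℕ) * v + J ^ (2:ℕ) * q₁ * u * v + J ^ (2:ℕ) * q₁ * u ^ (2:ℕ)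
          + (2 : ℝ) * J ^ (2:ℕ) * q₁ * v ^ (2:ℕ) + J ^ (2:ℕ) * q₁ ^ (2:ℕ) * v + (2 : ℝ) * J ^ (2:ℕ) * u * v ^ (2:ℕ) - (2 : ℝ) * J ^ (2:ℕ) * u ^ (2:ℕ) * v + J ^ (2:ℕ) * u ^ (3:ℕ)
          - (4 : ℝ) * J ^ (2:ℕ) * q₁ * u * v ^ (2:ℕ) + (2 : ℝ) * J ^ (2:ℕ) * q₁ * u ^ (2:ℕ) * v - J ^ (2:ℕ) * q₁ ^ (2:ℕ) * v ^ (2:ℕ) - (3 : ℝ) * J ^ (2:ℕ) * u ^ (2:ℕ) * v ^ (2:ℕ)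
          + (3 : ℝ) * J ^ (2:ℕ) * u ^ (3:ℕ) * v)
        + s * (u - (2 : ℝ) * u * v + J ^ (2:ℕ) * u + J * u * v ^ (2:ℕ) - (2 : ℝ) * J * u ^ (2:ℕ) * v + J ^ (2:ℕ) * q₁ * v - J ^ (2:ℕ) * u * v - (2 : ℝ) * J ^ (2:ℕ) * u ^ (2:ℕ)
            + (2 : ℝ) * u * v ^ (3:ℕ) - (2 : ℝ) * J * u * v ^ (3:ℕ) + (4 : ℝ) * J * u ^ (2:ℕ) * v ^ (2:ℕ) + J ^ (2:ℕ) * q₁ * u * v - (2 : ℝ) * J ^ (2:ℕ) * q₁ * v ^ (2:ℕ)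
            + (4 : ℝ) * J ^ (2:ℕ) * u * v ^ (2:ℕ) + (2 : ℝ) * J ^ (2:ℕ) * u ^ (2:ℕ) * v + J ^ (2:ℕ) * u ^ (3:ℕ) - u * v ^ (4:ℕ) + J * u * v ^ (4:ℕ)
            - (2 : ℝ) * J * u ^ (2:ℕ) * v ^ (3:ℕ) - (2 : ℝ) * J ^ (2:ℕ) * q₁ * u * v ^ (2:ℕ) + J ^ (2:ℕ) * q₁ * v ^ (3:ℕ) - (10 : ℝ) * J ^ (2:ℕ) * u ^ (2:ℕ) * v ^ (2:ℕ)
            + J ^ (2:ℕ) * u ^ (3:ℕ) * v - (2 : ℝ) * J ^ (3:ℕ) * u * v ^ (2:ℕ) + J ^ (3:ℕ) * u ^ (2:ℕ) * v + J ^ (4:ℕ) * q₁ * v + J ^ (4:ℕ) * u * v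
            + J ^ (2:ℕ) * q₁ * u * v ^ (3:ℕ) + (2 : ℝ) * J ^ (2:ℕ) * u ^ (2:ℕ) * v ^ (3:ℕ) + (2 : ℝ) * J ^ (2:ℕ) * u ^ (3:ℕ) * v ^ (2:ℕ)
            + (4 : ℝ) * J ^ (3:ℕ) * u ^ (2:ℕ) * v ^ (2:ℕ) - (2 : ℝ) * J ^ (3:ℕ) * u ^ (3:ℕ) * v - (3 : ℝ) * J ^ (4:ℕ) * q₁ * u * v - (3 : ℝ) * J ^ (4:ℕ) * u ^ (2:ℕ) * v
            - (2 : ℝ) * J ^ (3:ℕ) * u ^ (3:ℕ) * v ^ (2:ℕ) + J ^ (3:ℕ) * u ^ (4:ℕ) * v + (3 : ℝ) * J ^ (4:ℕ) * q₁ * u ^ (2:ℕ) * v + (3 : ℝ) * J ^ (4:ℕ) * u ^ (3:ℕ) * v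
            - J ^ (4:ℕ) * q₁ * u ^ (3:ℕ) * v - J ^ (4:ℕ) * u ^ (4:ℕ) * v)
        + s ^ 2 * (J ^ 2 * u * v * (J ^ 2 * (1 - u) ^ 3 + (1 - v) ^ 3)) := by
    rw [hp', hq']; ring
  have hThat : 0 ≤ p * q - p * u + q * v - (2 : ℝ) * p * q * v + p * u * v + (2 : ℝ) * p * u ^ (2:ℕ) + p ^ (2:ℕ) * u - (2 : ℝ) * q * v ^ (2:ℕ) - (2 : ℝ) * u * v ^ (2:ℕ)
      + (2 : ℝ) * u ^ (2:ℕ) * v - (2 : ℝ) * J * p * u * v + J * p * u ^ (2:ℕ) - (2 : ℝ) * J * q * u * v + J * q * v ^ (2:ℕ) + J ^ (2:ℕ) * p * q + J ^ (2:ℕ) * p * u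
      - J ^ (2:ℕ) * q * v + p * q * v ^ (2:ℕ) + (2 : ℝ) * p * u * v ^ (2:ℕ) - (4 : ℝ) * p * u ^ (2:ℕ) * v - p ^ (2:ℕ) * u ^ (2:ℕ) + q * v ^ (3:ℕ) + (3 : ℝ) * u * v ^ (3:ℕ)
      - (3 : ℝ) * u ^ (2:ℕ) * v ^ (2:ℕ) + (2 : ℝ) * J * p * u ^ (2:ℕ) * v - J * p * u ^ (3:ℕ) + (2 : ℝ) * J * q * u * v ^ (2:ℕ) - J * q * v ^ (3:ℕ) - (3 : ℝ) * J * u * v ^ (3:ℕ)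
      + (6 : ℝ) * J * u ^ (2:ℕ) * v ^ (2:ℕ) - (3 : ℝ) * J * u ^ (3:ℕ) * v - (2 : ℝ) * J ^ (2:ℕ) * p * q * u - (2 : ℝ) * J ^ (2:ℕ) * p * u ^ (2:ℕ) + J ^ (2:ℕ) * q * u * v
      + (2 : ℝ) * J ^ (2:ℕ) * q * v ^ (2:ℕ) + J ^ (2:ℕ) * q ^ (2:ℕ) * v + (2 : ℝ) * J ^ (2:ℕ) * u * v ^ (2:ℕ) - (2 : ℝ) * J ^ (2:ℕ) * u ^ (2:ℕ) * v
      + J ^ (2:ℕ) * p * q * u ^ (2:ℕ) + J ^ (2:ℕ) * p * u ^ (3:ℕ) - (4 : ℝ) * J ^ (2:ℕ) * q * u * v ^ (2:ℕ) + (2 : ℝ) * J ^ (2:ℕ) * q * u ^ (2:ℕ) * v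
      - J ^ (2:ℕ) * q ^ (2:ℕ) * v ^ (2:ℕ) - (3 : ℝ) * J ^ (2:ℕ) * u ^ (2:ℕ) * v ^ (2:ℕ) + (3 : ℝ) * J ^ (2:ℕ) * u ^ (3:ℕ) * v := by
    rw [hline]
    have hα' : 0 ≤ J ^ 2 * u * v * (J ^ 2 * (1 - u) ^ 3 + (1 - v) ^ 3) := by
      have := mul_nonneg (mul_nonneg (mul_nonneg (sq_nonneg J) hu.le) hv.le) hα
      simpa [mul_assoc] using this
    have h2 : 0 ≤ s * (u - (2 : ℝ) * u * v + J ^ (2:ℕ) * u + J * u * v ^ (2:ℕ) - (2 : ℝ) * J * u ^ (2:ℕ) * v + J ^ (2:ℕ) * q₁ * v - J ^ (2:ℕ) * u * v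
        - (2 : ℝ) * J ^ (2:ℕ) * u ^ (2:ℕ) + (2 : ℝ) * u * v ^ (3:ℕ) - (2 : ℝ) * J * u * v ^ (3:ℕ) + (4 : ℝ) * J * u ^ (2:ℕ) * v ^ (2:ℕ) + J ^ (2:ℕ) * q₁ * u * v
        - (2 : ℝ) * J ^ (2:ℕ) * q₁ * v ^ (2:ℕ) + (4 : ℝ) * J ^ (2:ℕ) * u * v ^ (2:ℕ) + (2 : ℝ) * J ^ (2:ℕ) * u ^ (2:ℕ) * v + J ^ (2:ℕ) * u ^ (3:ℕ) - u * v ^ (4:ℕ)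
        + J * u * v ^ (4:ℕ) - (2 : ℝ) * J * u ^ (2:ℕ) * v ^ (3:ℕ) - (2 : ℝ) * J ^ (2:ℕ) * q₁ * u * v ^ (2:ℕ) + J ^ (2:ℕ) * q₁ * v ^ (3:ℕ)
        - (10 : ℝ) * J ^ (2:ℕ) * u ^ (2:ℕ) * v ^ (2:ℕ) + J ^ (2:ℕ) * u ^ (3:ℕ) * v - (2 : ℝ) * J ^ (3:ℕ) * u * v ^ (2:ℕ) + J ^ (3:ℕ) * u ^ (2:ℕ) * v + J ^ (4:ℕ) * q₁ * v
        + J ^ (4:ℕ) * u * v + J ^ (2:ℕ) * q₁ * u * v ^ (3:ℕ) + (2 : ℝ) * J ^ (2:ℕ) * u ^ (2:ℕ) * v ^ (3:ℕ) + (2 : ℝ) * J ^ (2:ℕ) * u ^ (3:ℕ) * v ^ (2:ℕ)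
        + (4 : ℝ) * J ^ (3:ℕ) * u ^ (2:ℕ) * v ^ (2:ℕ) - (2 : ℝ) * J ^ (3:ℕ) * u ^ (3:ℕ) * v - (3 : ℝ) * J ^ (4:ℕ) * q₁ * u * v - (3 : ℝ) * J ^ (4:ℕ) * u ^ (2:ℕ) * v
        - (2 : ℝ) * J ^ (3:ℕ) * u ^ (3:ℕ) * v ^ (2:ℕ) + J ^ (3:ℕ) * u ^ (4:ℕ) * v + (3 : ℝ) * J ^ (4:ℕ) * q₁ * u ^ (2:ℕ) * v + (3 : ℝ) * J ^ (4:ℕ) * u ^ (3:ℕ) * v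
        - J ^ (4:ℕ) * q₁ * u ^ (3:ℕ) * v - J ^ (4:ℕ) * u ^ (4:ℕ) * v) := mul_nonneg hs0 hslope
    have h3 : 0 ≤ s ^ 2 * (J ^ 2 * u * v * (J ^ 2 * (1 - u) ^ 3 + (1 - v) ^ 3)) := mul_nonneg (sq_nonneg s) hα'
    linarith
  -- transfer: `u v T̂ = J T + λ Q_c`
  have htrans : u * v * (p * q - p * u + q * v - (2 : ℝ) * p * q * v + p * u * v + (2 : ℝ) * p * u ^ (2:ℕ) + p ^ (2:ℕ) * u - (2 : ℝ) * q * v ^ (2:ℕ) - (2 : ℝ) * u * v ^ (2:ℕ)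
      + (2 : ℝ) * u ^ (2:ℕ) * v - (2 : ℝ) * J * p * u * v + J * p * u ^ (2:ℕ) - (2 : ℝ) * J * q * u * v + J * q * v ^ (2:ℕ) + J ^ (2:ℕ) * p * q + J ^ (2:ℕ) * p * u
      - J ^ (2:ℕ) * q * v + p * q * v ^ (2:ℕ) + (2 : ℝ) * p * u * v ^ (2:ℕ) - (4 : ℝ) * p * u ^ (2:ℕ) * v - p ^ (2:ℕ) * u ^ (2:ℕ) + q * v ^ (3:ℕ) + (3 : ℝ) * u * v ^ (3:ℕ)
      - (3 : ℝ) * u ^ (2:ℕ) * v ^ (2:ℕ) + (2 : ℝ) * J * p * u ^ (2:ℕ) * v - J * p * u ^ (3:ℕ) + (2 : ℝ) * J * q * u * v ^ (2:ℕ) - J * q * v ^ (3:ℕ) - (3 : ℝ) * J * u * v ^ (3:ℕ)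
      + (6 : ℝ) * J * u ^ (2:ℕ) * v ^ (2:ℕ) - (3 : ℝ) * J * u ^ (3:ℕ) * v - (2 : ℝ) * J ^ (2:ℕ) * p * q * u - (2 : ℝ) * J ^ (2:ℕ) * p * u ^ (2:ℕ) + J ^ (2:ℕ) * q * u * v
      + (2 : ℝ) * J ^ (2:ℕ) * q * v ^ (2:ℕ) + J ^ (2:ℕ) * q ^ (2:ℕ) * v + (2 : ℝ) * J ^ (2:ℕ) * u * v ^ (2:ℕ) - (2 : ℝ) * J ^ (2:ℕ) * u ^ (2:ℕ) * v
      + J ^ (2:ℕ) * p * q * u ^ (2:ℕ) + J ^ (2:ℕ) * p * u ^ (3:ℕ) - (4 : ℝ) * J ^ (2:ℕ) * q * u * v ^ (2:ℕ) + (2 : ℝ) * J ^ (2:ℕ) * q * u ^ (2:ℕ) * v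
      - J ^ (2:ℕ) * q ^ (2:ℕ) * v ^ (2:ℕ) - (3 : ℝ) * J ^ (2:ℕ) * u ^ (2:ℕ) * v ^ (2:ℕ) + (3 : ℝ) * J ^ (2:ℕ) * u ^ (3:ℕ) * v)
      = J * ((u ^ 2 / J) * (p + (1 - J) * v ^ 2) * (v * (v - u) + p * (1 - u))
        + v ^ 2 * (J * q + (J - 1) * u ^ 2) * (u * (u - v) + q * (1 - v)))
        + (p * u - q * v - p * u ^ (2:ℕ) + q * v ^ (2:ℕ) + (2 : ℝ) * u * v ^ (2:ℕ) - (2 : ℝ) * u ^ (2:ℕ) * v) * (v * (1 - u) * (q + u) * J ^ 2 + u * v * (u - v) * J - u * (1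
            - v) * (v + p)) := by
    field_simp
    ring
  rw [hQ, mul_zero, add_zero] at htrans
  have hJT : 0 ≤ J * ((u ^ 2 / J) * (p + (1 - J) * v ^ 2) * (v * (v - u) + p * (1 - u))
        + v ^ 2 * (J * q + (J - 1) * u ^ 2) * (u * (u - v) + q * (1 - v))) := by
    rw [← htrans]; exact mul_nonneg (mul_nonneg hu.le hv.le) hThat
  exact (mul_nonneg_iff_of_pos_left hJ).mp hJT

end Summit.HubbardSuperconductivity.HubbardSuperconductivity.Theorems.AnisotropyChord.TwoMagnon
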